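import Literature.Topology.FourManifolds.KhComplexFaceProofs
import Literature.Topology.FourManifolds.KhFlipDegree
import Literature.Topology.FourManifolds.LeeRasmussenProofs
import HarnessLib

/-!
# Pushing and pulling enhanced states along a merge or a split edge

Sibling file of `KhComplex.lean`, a brick of the invariance programme for
`Literature.Topology.FourManifolds.GaussDiagram.nonempty_iso_khovanovHomology_of_equiv`
(Khovanov (2000), Thm. 1). The cancellations of the second and third Reidemeister moves
(Khovanov (2000), §5.3–5.4; Bar-Natan (2002), §4) identify generators of the cube complex across
an edge `σ → σ[i ↦ 1]` of the cube: along a **split** the generators over `σ[i ↦ 1]` are the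
generators over `σ` together with the labels of the two new circles, along a **merge** the
generators over `σ[i ↦ 1]` are the generators over `σ` with the two labels on the merged circles
forgotten and one new label. This file packages these bijections of bases as operations on
enhanced states (thin wrappers around the labelling calculus `KhFace.upd`, `KhFace.updLab`,
`KhFace.updLab₂` of `KhFaces` and the surgery relations `IsMergeAt.surg`, `IsSplitAt.surg` of
`KhComplexFaceProofs`):

* `IsSplitAt.push h la v w` / `IsSplitAt.pull h mu z` — across a split edge: put the labels `v`,
  `w` on the two new circles / put `z` on the re-united circle; `IsMergeAt.push h la z` /
  `IsMergeAt.pull h mu v w` — across a merge edge; the round trips `pull_push`, `push_pull`;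
* `incidence_push` — **the incidence number towards a pushed state is the Koszul sign times the
  entry of the (co)multiplication table** (`splitCoeff (la a) v w`, resp.
  `mergeCoeff (la a) (la b) z`), and `eq_push_of_incidence_ne_zero` — **every state across the
  edge with nonzero incidence number is a pushed state** (the transcription of the agreement
  clause of `GaussDiagram.incidence`, `KhFace.forall_iff_eq_upd(_upd)`).

These are the matrix entries `Δ : V → V ⊗ A`, `m : V ⊗ A → V` of Khovanov (2000), §2.2, (4)–(5),
read on the basis of enhanced states (Viro (2004), §5.2). Everything is proved; no named fact is
introduced.

## References

* M. Khovanov, *A categorification of the Jones polynomial*, Duke Math. J. 101 (2000) 359–426,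
  §2.2, §4.2. [cite: Khovanov2000, §4.2]
* O. Viro, *Khovanov homology, its definitions and ramifications*, Fund. Math. 184 (2004)
  317–342, §5.2 (enhanced states, the differential as a matrix). [cite: Viro2004, §5.2]
* D. Bar-Natan, *On Khovanov's categorification of the Jones polynomial*, Algebr. Geom. Topol. 2
  (2002) 337–370, §3.1–3.2. [cite: BarNatan2002, §3.2]
-/

open Function

noncomputable section

namespace Literature.Topology.FourManifolds

/-! ## Abstract round trips of the labelling calculus -/

namespace KhFace

variable {X : Type*} {Y Y' : Type*} [DecidableEq Y] [DecidableEq Y'] {c : X → Y} {c' : X → Y'}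
  {α β : X}

/-- Refining a labelling of the coarse classes to the two fine classes and coarsening it back
with the old value is the identity. [folklore] -/
theorem upd_upd_upd_coarse (S : Surg c c' α β) (la : Lab c') (v w : Bool) :
    upd c' (upd c (upd c la.1 β w) α v) α (la.1 α) = la.1 := by
  funext x
  by_cases hx : c' x = c' α
  · rw [upd_of_eq hx]
    exact la.2 α x hx.symm
  · rw [upd_of_ne hx]
    have hxa : c x ≠ c α := fun h ↦ hx (S.le h)
    have hxb : c x ≠ c β := fun h ↦ hx ((S.le h).trans S.eq.symm)
    rw [upd_of_ne hxa, upd_of_ne hxb]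

/-- Coarsening a labelling of the fine classes and refining it back with the old values is the
identity. [folklore] -/
theorem upd_upd_upd_fine (S : Surg c c' α β) (mu : Lab c) (z : Bool) :
    upd c (upd c (upd c' mu.1 α z) β (mu.1 β)) α (mu.1 α) = mu.1 := by
  funext x
  by_cases hxa : c x = c α
  · rw [upd_of_eq hxa]
    exact mu.2 α x hxa.symm
  · rw [upd_of_ne hxa]
    by_cases hxb : c x = c β
    · rw [upd_of_eq hxb]
      exact mu.2 β x hxb.symm
    · rw [upd_of_ne hxb, upd_of_ne]
      intro h
      rcases (S.eq_iff x).1 h with h' | h'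
      · exact hxa h'
      · exact hxb h'

end KhFace

namespace GaussDiagram

variable {G : GaussDiagram}

/-! ## The labelling underlying an enhanced state -/

/-- The labelling of the circles of `τ` underlying an enhanced state whose state is `τ` (labels
are functions on arcs; only the constancy proof is transported). [folklore] -/
def EnhancedState.lab (s : G.EnhancedState) {τ : G.State} (hs : s.state = τ) :
    KhFace.Lab (G.circleOf τ) :=
  ⟨s.label, fun a b hab ↦ s.label_eq_of_circleOf_eq (by rw [hs]; exact hab)⟩

/-- The labelling underlying an enhanced state, as a function. [folklore] -/
@[simp]
theorem EnhancedState.lab_val (s : G.EnhancedState) {τ : G.State} (hs : s.state = τ) :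
    (s.lab hs).1 = s.label := rfl

/-- An enhanced state is recovered from its state and its labelling. [folklore] -/
theorem ofLab_lab (s : G.EnhancedState) {τ : G.State} (hs : s.state = τ) :
    G.ofLab τ (s.lab hs) = s :=
  EnhancedState.ext' hs.symm rfl

/-! ## Across a split edge -/

namespace IsSplitAt

variable {σ : G.State} {i : Fin G.n} (h : G.IsSplitAt σ i)

/-- **Push an enhanced state across a split edge** `σ → σ[i ↦ 1]`: keep the labels off the split
circle and put `v` on the new circle of the strand `arcIn (overPos i)`, `w` on the new circle of
the strand `arcOut (overPos i)` — the basis vector `· ⊗ v ⊗ w` in the target of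
`Δ : V → V ⊗ A ⊗ A`-with-one-circle-split. Khovanov (2000), §2.2, §4.2; Viro (2004), §5.2.
[cite: Viro2004, §5.2] -/
def push (la : KhFace.Lab (G.circleOf σ)) (v w : Bool) : G.EnhancedState :=
  G.ofLab (Function.update σ i true) (KhFace.updLab₂ h.surg la v w)

/-- **Pull an enhanced state back across a split edge**: from a labelling of the circles of
`σ[i ↦ 1]`, the enhanced state over `σ` with the same labels off the split circle and the label
`z` on the (re-united) split circle. [folklore] -/
def pull (mu : KhFace.Lab (G.circleOf (Function.update σ i true))) (z : Bool) :
    G.EnhancedState :=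
  G.ofLab σ (KhFace.updLab h.surg mu z)

/-- The state of a pushed state. [folklore] -/
@[simp] theorem push_state (la : KhFace.Lab (G.circleOf σ)) (v w : Bool) :
    (h.push la v w).state = Function.update σ i true := rfl

/-- The labels of a pushed state. [folklore] -/
theorem push_label (la : KhFace.Lab (G.circleOf σ)) (v w : Bool) (u : G.Arc) :
    (h.push la v w).label u =
      if G.circleOf (Function.update σ i true) u =
          G.circleOf (Function.update σ i true) (G.arcIn (G.overPos i)) then v
      else if G.circleOf (Function.update σ i true) u =
          G.circleOf (Function.update σ i true) (G.arcOut (G.overPos i)) then w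
      else la.1 u := rfl

/-- The label of a pushed state on the first new circle. [folklore] -/
theorem push_label_arcIn (la : KhFace.Lab (G.circleOf σ)) (v w : Bool) :
    (h.push la v w).label (G.arcIn (G.overPos i)) = v := by
  rw [push_label, if_pos rfl]

/-- The label of a pushed state on the second new circle. [folklore] -/
theorem push_label_arcOut (la : KhFace.Lab (G.circleOf σ)) (v w : Bool) :
    (h.push la v w).label (G.arcOut (G.overPos i)) = w := by
  rw [push_label, if_neg h.2.symm, if_pos rfl]

/-- The labels of a pushed state off the split circle are the old ones. [folklore] -/
theorem push_label_of_ne (la : KhFace.Lab (G.circleOf σ)) (v w : Bool) {u : G.Arc}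
    (hu : G.circleOf σ u ≠ G.circleOf σ (G.arcIn (G.overPos i))) :
    (h.push la v w).label u = la.1 u := by
  have S := h.surg
  rw [push_label, if_neg fun e ↦ hu (S.le e),
    if_neg fun e ↦ hu ((S.le e).trans S.eq.symm)]

/-- The state of a pulled state. [folklore] -/
@[simp] theorem pull_state (mu : KhFace.Lab (G.circleOf (Function.update σ i true))) (z : Bool) :
    (h.pull mu z).state = σ := rfl

/-- The labels of a pulled state. [folklore] -/
theorem pull_label (mu : KhFace.Lab (G.circleOf (Function.update σ i true))) (z : Bool)
    (u : G.Arc) :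
    (h.pull mu z).label u =
      if G.circleOf σ u = G.circleOf σ (G.arcIn (G.overPos i)) then z else mu.1 u := rfl

/-- **Pull after push is the identity** (with the old label on the re-united circle). [folklore] -/
theorem pull_push (la : KhFace.Lab (G.circleOf σ)) (v w : Bool) :
    h.pull ((h.push la v w).lab rfl) (la.1 (G.arcIn (G.overPos i))) = G.ofLab σ la :=
  EnhancedState.ext' rfl (KhFace.upd_upd_upd_coarse h.surg la v w)

/-- **Push after pull is the identity** (with the old labels on the two new circles). [folklore] -/
theorem push_pull (mu : KhFace.Lab (G.circleOf (Function.update σ i true))) (z : Bool) :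
    h.push ((h.pull mu z).lab rfl) (mu.1 (G.arcIn (G.overPos i)))
      (mu.1 (G.arcOut (G.overPos i))) = G.ofLab _ mu :=
  EnhancedState.ext' rfl (KhFace.upd_upd_upd_fine h.surg mu z)

include h in
/-- A split is not a merge. [folklore] -/
theorem not_isMergeAt : ¬ G.IsMergeAt σ i := fun hm ↦ IsMergeAt.not_isSplitAt_holds hm h

section Ring

variable {R : Type} [CommRing R] (hR tR : R)

/-- **The incidence number towards a pushed state across a split**: zero unless the pushed
labelling agrees with the source off the split circle, and then the Koszul sign times the entry
`splitCoeff (label a) v w` of the comultiplication table (`Δ 1 = 1 ⊗ X + X ⊗ 1 - h 1 ⊗ 1`,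
`Δ X = X ⊗ X + t 1 ⊗ 1`). Khovanov (2000), (5), §4.2; Viro (2004), §5.2. [cite: Viro2004, §5.2] -/
theorem incidence_push' (s : G.EnhancedState) (hs : s.state = σ) (la : KhFace.Lab (G.circleOf σ))
    (v w : Bool) :
    G.incidence R hR tR s (h.push la v w) =
      if ∀ u, G.circleOf σ u ≠ G.circleOf σ (G.arcIn (G.overPos i)) → la.1 u = s.label u then
        (edgeSign σ i : R) * splitCoeff R hR tR (s.label (G.arcIn (G.overPos i))) v w
      else 0 := by
  subst hs
  rw [G.incidence_of_flip R hR tR h.1 (h.push_state la v w), if_neg h.not_isMergeAt, if_pos h,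
    push_label_arcIn, push_label_arcOut]
  have e : (∀ c, G.circleOf s.state c ≠ G.circleOf s.state (G.arcIn (G.overPos i)) →
      (h.push la v w).label c = s.label c) ↔
      ∀ u, G.circleOf s.state u ≠ G.circleOf s.state (G.arcIn (G.overPos i)) →
        la.1 u = s.label u :=
    forall_congr' fun u ↦ imp_congr_right fun hu ↦ by rw [h.push_label_of_ne la v w hu]
  rw [if_congr e rfl rfl]

/-- The incidence number towards the push of the source itself is the Koszul sign times the entry
of the comultiplication table. [cite: Viro2004, §5.2] -/
theorem incidence_push (s : G.EnhancedState) (hs : s.state = σ) (v w : Bool) :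
    G.incidence R hR tR s (h.push (s.lab hs) v w) =
      (edgeSign σ i : R) * splitCoeff R hR tR (s.label (G.arcIn (G.overPos i))) v w := by
  rw [h.incidence_push' hR tR s hs]
  exact if_pos fun u _ ↦ rfl

/-- **Across a split edge, every state with nonzero incidence number is a pushed state.**
[folklore] -/
theorem eq_push_of_incidence_ne_zero {s s' : G.EnhancedState} (hs : s.state = σ)
    (hs' : s'.state = Function.update σ i true) (hne : G.incidence R hR tR s s' ≠ 0) :
    s' = h.push (s.lab hs) (s'.label (G.arcIn (G.overPos i)))
      (s'.label (G.arcOut (G.overPos i))) := by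
  subst hs
  rw [G.incidence_of_flip R hR tR h.1 hs', if_neg h.not_isMergeAt, if_pos h] at hne
  by_cases hc : ∀ c, G.circleOf s.state c ≠ G.circleOf s.state (G.arcIn (G.overPos i)) →
      s'.label c = s.label c
  · have key := (KhFace.forall_iff_eq_upd_upd h.surg (s.lab rfl) (s'.lab hs')).1 hc
    exact EnhancedState.ext' hs' key
  · exact (hne (by rw [if_neg hc])).elim

end Ring

end IsSplitAt

/-! ## Across a merge edge -/

namespace IsMergeAt

variable {σ : G.State} {i : Fin G.n} (h : G.IsMergeAt σ i)

/-- **Push an enhanced state across a merge edge** `σ → σ[i ↦ 1]`: keep the labels off the two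
merged circles and put `z` on the merged circle — the basis vector `· ⊗ z` in the target of the
multiplication `m`. Khovanov (2000), §2.2, §4.2; Viro (2004), §5.2. [cite: Viro2004, §5.2] -/
def push (la : KhFace.Lab (G.circleOf σ)) (z : Bool) : G.EnhancedState :=
  G.ofLab (Function.update σ i true) (KhFace.updLab h.surg la z)

/-- **Pull an enhanced state back across a merge edge**: from a labelling of the circles of
`σ[i ↦ 1]`, the enhanced state over `σ` with the same labels off the merged circle and the labels
`v`, `w` on the circles of the strands `arcIn (overPos i)`, `arcOut (overPos i)`. [folklore] -/
def pull (mu : KhFace.Lab (G.circleOf (Function.update σ i true))) (v w : Bool) :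
    G.EnhancedState :=
  G.ofLab σ (KhFace.updLab₂ h.surg mu v w)

/-- The state of a pushed state. [folklore] -/
@[simp] theorem push_state (la : KhFace.Lab (G.circleOf σ)) (z : Bool) :
    (h.push la z).state = Function.update σ i true := rfl

/-- The labels of a pushed state. [folklore] -/
theorem push_label (la : KhFace.Lab (G.circleOf σ)) (z : Bool) (u : G.Arc) :
    (h.push la z).label u =
      if G.circleOf (Function.update σ i true) u =
          G.circleOf (Function.update σ i true) (G.arcIn (G.overPos i)) then z
      else la.1 u := rfl

/-- The label of a pushed state on the merged circle. [folklore] -/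
theorem push_label_arcIn (la : KhFace.Lab (G.circleOf σ)) (z : Bool) :
    (h.push la z).label (G.arcIn (G.overPos i)) = z := by
  rw [push_label, if_pos rfl]

/-- The labels of a pushed state off the merged circle are the old ones. [folklore] -/
theorem push_label_of_ne (la : KhFace.Lab (G.circleOf σ)) (z : Bool) {u : G.Arc}
    (hu : G.circleOf (Function.update σ i true) u ≠
      G.circleOf (Function.update σ i true) (G.arcIn (G.overPos i))) :
    (h.push la z).label u = la.1 u := by
  rw [push_label, if_neg hu]

/-- The state of a pulled state. [folklore] -/
@[simp] theorem pull_state (mu : KhFace.Lab (G.circleOf (Function.update σ i true)))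
    (v w : Bool) : (h.pull mu v w).state = σ := rfl

/-- The labels of a pulled state. [folklore] -/
theorem pull_label (mu : KhFace.Lab (G.circleOf (Function.update σ i true))) (v w : Bool)
    (u : G.Arc) :
    (h.pull mu v w).label u =
      if G.circleOf σ u = G.circleOf σ (G.arcIn (G.overPos i)) then v
      else if G.circleOf σ u = G.circleOf σ (G.arcOut (G.overPos i)) then w
      else mu.1 u := rfl

/-- **Pull after push is the identity** (with the old labels on the two circles). [folklore] -/
theorem pull_push (la : KhFace.Lab (G.circleOf σ)) (z : Bool) :
    h.pull ((h.push la z).lab rfl) (la.1 (G.arcIn (G.overPos i)))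
      (la.1 (G.arcOut (G.overPos i))) = G.ofLab σ la :=
  EnhancedState.ext' rfl (KhFace.upd_upd_upd_fine h.surg la z)

/-- **Push after pull is the identity** (with the old label on the merged circle). [folklore] -/
theorem push_pull (mu : KhFace.Lab (G.circleOf (Function.update σ i true))) (v w : Bool) :
    h.push ((h.pull mu v w).lab rfl) (mu.1 (G.arcIn (G.overPos i))) = G.ofLab _ mu :=
  EnhancedState.ext' rfl (KhFace.upd_upd_upd_coarse h.surg mu v w)

section Ring

variable {R : Type} [CommRing R] (hR tR : R)

/-- **The incidence number towards a pushed state across a merge**: zero unless the pushed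
labelling agrees with the source off the merged circle, and then the Koszul sign times the entry
`mergeCoeff (label a) (label b) z` of the multiplication table (`1·1 = 1`, `1·X = X·1 = X`,
`X·X = hX + t`). Khovanov (2000), (4), §4.2; Viro (2004), §5.2. [cite: Viro2004, §5.2] -/
theorem incidence_push' (s : G.EnhancedState) (hs : s.state = σ) (la : KhFace.Lab (G.circleOf σ))
    (z : Bool) :
    G.incidence R hR tR s (h.push la z) =
      if ∀ u, G.circleOf (Function.update σ i true) u ≠
          G.circleOf (Function.update σ i true) (G.arcIn (G.overPos i)) → la.1 u = s.label u then
        (edgeSign σ i : R) * mergeCoeff R hR tR (s.label (G.arcIn (G.overPos i)))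
          (s.label (G.arcOut (G.overPos i))) z
      else 0 := by
  subst hs
  rw [G.incidence_of_flip R hR tR h.1 (h.push_state la z), if_pos h, push_label_arcIn]
  have e : (∀ c, G.circleOf (h.push la z).state c ≠
      G.circleOf (h.push la z).state (G.arcIn (G.overPos i)) →
      (h.push la z).label c = s.label c) ↔
      ∀ u, G.circleOf (Function.update s.state i true) u ≠
        G.circleOf (Function.update s.state i true) (G.arcIn (G.overPos i)) →
        la.1 u = s.label u :=
    forall_congr' fun u ↦ imp_congr_right fun hu ↦ by rw [h.push_label_of_ne la z hu]
  rw [if_congr e rfl rfl]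

/-- The incidence number towards the push of the source itself is the Koszul sign times the entry
of the multiplication table. [cite: Viro2004, §5.2] -/
theorem incidence_push (s : G.EnhancedState) (hs : s.state = σ) (z : Bool) :
    G.incidence R hR tR s (h.push (s.lab hs) z) =
      (edgeSign σ i : R) * mergeCoeff R hR tR (s.label (G.arcIn (G.overPos i)))
        (s.label (G.arcOut (G.overPos i))) z := by
  rw [h.incidence_push' hR tR s hs]
  exact if_pos fun u _ ↦ rfl

/-- **Across a merge edge, every state with nonzero incidence number is a pushed state.**
[folklore] -/
theorem eq_push_of_incidence_ne_zero {s s' : G.EnhancedState} (hs : s.state = σ)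
    (hs' : s'.state = Function.update σ i true) (hne : G.incidence R hR tR s s' ≠ 0) :
    s' = h.push (s.lab hs) (s'.label (G.arcIn (G.overPos i))) := by
  subst hs
  rw [G.incidence_of_flip R hR tR h.1 hs', if_pos h] at hne
  by_cases hc : ∀ c, G.circleOf s'.state c ≠ G.circleOf s'.state (G.arcIn (G.overPos i)) →
      s'.label c = s.label c
  · have hc' : ∀ c, G.circleOf (Function.update s.state i true) c ≠
        G.circleOf (Function.update s.state i true) (G.arcIn (G.overPos i)) →
        (s'.lab hs').1 c = (s.lab rfl).1 c :=
      fun c hcu ↦ hc c (by rw [hs']; exact hcu)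
    have key := (KhFace.forall_iff_eq_upd (c := G.circleOf s.state) (s.lab rfl) (s'.lab hs')).1
      hc'
    exact EnhancedState.ext' hs' key
  · exact (hne (by rw [if_neg hc])).elim

end Ring

end IsMergeAt

end GaussDiagram

end Literature.Topology.FourManifolds
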